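import Summits.BirchSwinnertonDyer.Rank1Residual.GaloisImage.KuriharaRecordBSDpThreeDeep
import Summits.BirchSwinnertonDyer.Rank1Residual.Additive.X4ThreeKolyvaginLevelCertificates
import Summits.BirchSwinnertonDyer.Rank1Residual.Additive.JValuationOfIntModel
import Summits.BirchSwinnertonDyer.Rank1Residual.GaloisImage.LocalThreeTorsionRecords
import HarnessLib

/-!
# N11 LOWER@3 — ROUTE-1 PILOT RECORD A2: `BSD(E,3)` for `17190k1` at the `𝒩₃`-level `541·811 = 438751`
# WITHOUT the [K25] preprint — through p18's DEEP record-ready END corollary (ROUTE-1 sub-route (a′),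
# R1-45 (e) / R1-46 S-B1 sentinel A2, `t = 1`)
# (cell `b2b-bsdres`, team n1011, seat p03 gen 6, row T-a2-REC kernel-node lane / skel/T-R1-PILOT.md;
# consumers of `GaloisImage/KuriharaRecordBSDpThreeDeep` (p18), `Additive/X4ThreeKolyvaginLevelCertificates`
# (p03), `Additive/X4ThreeKuriharaCertRecordsS2_23` (p03), `GaloisImage/LocalThreeTorsionRecords` (p17))

HONEST FRAMING (cell `b2b-bsdres`, run/shared/lean/b2b/bsd-rank1-residual/, verbatim in every
file): the goal of the cell is to DELETE the COMBINATION-SHAPED residual classes of the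
Birch–Swinnerton-Dyer formula for ALL analytic-rank `≤ 1` elliptic curves over `ℚ` — "full BSD
formula for every rank `≤ 1` curve in class `C`" assembled STRICTLY from published theorems — so
that the rank-`≤ 1` remainder becomes exactly the CONSTRUCTION-SHAPED classes, which are TYPED
(missing-input `Prop`s), NOT attempted. This is not "finishing BSD". Team n1011 is a RESEARCH ROUTE;
no claim beyond the stated classes; the label X4 and the mark of RESIDUAL-MAP §I N11 (LOWER@3) are
UNCHANGED; a PER-PAIR record, not a class theorem; an EVIDENCE-grade booking CANDIDATE for the
director, nothing is booked by this file. Theorems only (no definition, no named fact).  The Kolyvagin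
certificate (`ψ`, `hψ`, `hcert`, `hv`) and every fact / port binder STAY HYPOTHESES (lead R5-66 (n)).

## What this file does

**`bsdp3_route1_v17190k1`**: p18's `Assembly.bsdp_three_potMult_of_towerSurj_of_kolyvaginProduct_deep`
(row T-R1-45 FILE E4: class A2, `t = k = 1`, `j = 1`, DEEP side) for the POTENTIALLY MULTIPLICATIVE
row `17190k1` (`N = 17190 = 2·3²·5·191`, `v₃(j) = −5 < 0`, `#E(ℚ₃)[3] = 3`, `∏ c_ℓ = 4`, `#Ш_an = 9`)
at the `𝒩₃` level `n = 541·811 = 438751` (both primes `≡ 1 (mod 27)`, `27 ∣ #Ẽ(𝔽_ℓ)`), with the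
curve-side inputs IN THE KERNEL BY NAME — integer model, `3 ∣ Δ`, `3 ∣ c₄`, `ord₃ j < 0`
(`padicValRat_j_neg_of_intModel`, certificate `a = 2`: `3³ ∤ c₄`, `3⁷ ∣ Δ`), the `3`-adic tower and
`3 ∤ c(W/ℚ₃)` via `∏ c_ℓ = 4` (`towerSurj3_v17190k1`, `tamagawaProduct_v17190k1`, S2_23 p274937),
`#E(ℚ₃)[3] = 3¹` (p17's `LocalTorsion3.natCard_threeTorsion_17190k1`, T-LOC3T C3 p285951), the LEVEL
`438751 ∈ 𝒩₃`, cyclicity and `ℓ ∤ 17190` (`isKolyvaginProduct_three_v17190k1`,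
`forall_card_torsion_le_v17190k1`, `forall_not_dvd_level_v17190k1`, p284347) — CONDITIONAL on the
named inputs {the two S24-DEEP ports `hS24d`/`hS24d₂`, the Poitou–Tate families, Tate's `hEP`, the
port `KatoKuriharaPortThreeAt W 1 v₃` (FLAG `K22-Thm3.13-PORT@3`), the X4 upper-half facts
`hKatoS hDel hmodD hL20 hKatoχ`, `hGZK`, `hmod`, `h26`} and the per-pair EVIDENCE binders `hr`, the
OPTIMAL datum `D`/`hopt` at level `17190 ≤ 130000`, and the certificate `hδ` = (`∃ ψ` surjective,
`δ̃_{438751}(ψ) ≢ 0 (mod 3)`, the two single-prime vanishings).  STATUS of the VALUE: NO engine has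
reported `δ̃_{541·811}` for this row (its E2-AT3 record level is `43·157`); the binder is an honest
HYPOTHESIS awaiting a two-source certificate — this file is the KERNEL SHAPE of the A2 sentinel
(r1 ROUTE-1 §26.4 / §29.5), not a filled record.

LEVEL / MODULUS MATCH (referee-1 ACK-1 proviso (i)): E4 takes `hn : Kato.IsKolyvaginProduct W 3 (t + t + 1) n`
at `t = 1`, i.e. `n ∈ 𝒩₃` — supplied BY NAME by `isKolyvaginProduct_three_v17190k1 : IsKolyvaginProduct W 3 3 438751`
(p284347; `1 + 1 + 1 = 3` by `rfl`) — while the Kurihara certificate itself is at modulus `3^j = 3^1`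
(`j = 1`, E3's `htj`), i.e. `kuriharaNumber D.f (3^1) 438751 ψ ≠ 0` with `ψ` onto `ℤ/3`: this is Kim's
Thm 1.9 (6) shape at `(t, k, j) = (1, 1, 1)` exactly as in `exists_LOmega_padicValRat_le_of_towerSurj_deep`.

Nothing booked; no port / fact discharged; X4 CONSTRUCTION-SHAPED.

References: [Kim2022StructureSelmer] Thm. 1.9 (6), §1.2.2; [Sakamoto2024] Thm. 4.4; [Delbourgo1998]
Prop. 4; [Wuthrich2014] Lemma 20; [AgasheRibetStein2006] Thm. 2.6; [Miller2011LMS] Def. 1.1;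
[SilvermanAEC2009] VII.5 Prop. 5.1 (b); [CremonaAlgorithms1997] Table 1.
-/

set_option autoImplicit false

noncomputable section

open scoped Classical NumberField

open Function NumberField IsDedekindDomain WeierstrassCurve
  Literature.NumberTheory.EllipticCurves Literature.NumberTheory.EllipticCurves.ModularForms
  Literature.NumberTheory.EllipticCurves.Rank1Residual
  Literature.NumberTheory.EllipticCurves.AgasheRibetStein2006
  Literature.NumberTheory.GaloisRepresentations
  Literature.NumberTheory.GaloisRepresentations.DiscreteGaloisModule Literature.NumberTheory.GaloisCohomology
  IsDedekindDomain.HeightOneSpectrum Rat.HeightOneSpectrum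
  Summit.BirchSwinnertonDyer.Rank1Residual.GaloisImage Summit.BirchSwinnertonDyer.Rank1Residual.X4

namespace Summit.BirchSwinnertonDyer.Rank1Residual.Additive.X4ThreeKuriharaCert

/-- **ROUTE-1 PILOT RECORD A2: `BSD(E,3)` for `17190k1` at the `𝒩₃` level `n = 541·811 = 438751`,
[K25]-FREE, DEEP side (`t = 1`)** — for any globally minimal elliptic `W/ℚ` with Cremona's integral
model `[1, -1, 0, 97843986, -294942486060]`: p18's
`Assembly.bsdp_three_potMult_of_towerSurj_of_kolyvaginProduct_deep` with the curve-side inputs BY NAME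
from the kernel and the NAMED typed inputs / the certificate as hypotheses.  CERTIFICATE SHAPE (the
VALUE at `438751` is not yet reported by any engine); nothing booked; no mark moved.
[cite: Kim2022StructureSelmer, Thm. 1.9 (6), §1.2.2] [cite: Sakamoto2024, Thm. 4.4 (p. 926)]
[cite: Delbourgo1998, Prop. 4 (p. 144)] [cite: Wuthrich2014, Lemma 20 (p. 399)]
[cite: SilvermanAEC2009, VII.5 Prop. 5.1 (b)] [cite: CremonaAlgorithms1997, Table 1] -/
theorem bsdp3_route1_v17190k1
    (hKatoS : Kato2004.rankZero_padicValNat_sha_le_sub_localTamagawa_of_additive_potGood_of_imageContainsSL2)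
    (hDel : Delbourgo1998.prop4_rankZero_pow_dvd_constantCoeff)
    (hGZK : rank_eq_analyticRank_of_analyticRank_le_one) (hmod : hasEntireLFunction_rat)
    (hmodD : nonempty_modularParametrizationData)
    (hL20 : Wuthrich2014.lemma20_surjective_threeAdic_of_semistable)
    (hKatoχ : Wuthrich2014.kato_halfEigenCharIdeal_dvd_cyclotomicPrime_of_surjective)
    (h26 : cremona_abs_maninConstant_eq_one_of_level_le)
    (hS24d : S24Deep.kolyvaginSystems_freeRankOne_zmod_three_pow_deep)
    (hS24d₂ : S24Deep.kolyvaginSystems_idealOfBasis_eq_fittingIdeal_zmod_three_pow_deep)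
    {W : WeierstrassCurve ℚ} [W.IsElliptic] [W.IsGloballyMinimal]
    (hI : integralModelInt W = ⟨1, -1, 0, 97843986, -294942486060⟩)
    (hr : W.analyticRank = 0)
    (D : ModularParametrizationData W 17190)
    (hopt : ∀ z ∈ D.L.lattice, ∃ w ∈ periodLattice D.f, z = D.c * w)
    (inv : LocalInvariants ℚ 3) (hperf : inv.IsPerfect) (hsum : inv.SumLocalTermEqZero)
    (hcompl : inv.SelmerComplement)
    (inv' : ∀ k' : ℕ, LocalInvariants ℚ (3 ^ (k' + 1))) (hperf' : ∀ k', (inv' k').IsPerfect)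
    (hsum' : ∀ k', (inv' k').SumLocalTermEqZero) (hcompl' : ∀ k', (inv' k').SelmerComplement)
    (hinj' : ∀ k', ∀ v : HeightOneSpectrum (𝓞 ℚ), Injective (inv' k' (Sum.inr v)))
    (hEP : ∀ v : HeightOneSpectrum (𝓞 ℚ), localEulerPoincareCharacteristic (v.adicCompletion ℚ))
    (v₃ : HeightOneSpectrum (𝓞 ℚ)) (hv₃ : ((3 : ℕ) : 𝓞 ℚ) ∈ v₃.asIdeal)
    (hPort : KatoKuriharaPortThreeAt W 1 v₃)
    (hδ : ∃ ψ : (ℓ : ℕ) → (ZMod ℓ)ˣ →* Multiplicative (ZMod (3 ^ 1)),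
      (∀ ℓ ∈ (438751 : ℕ).primeFactors, Function.Surjective (ψ ℓ)) ∧
        kuriharaNumber D.f (3 ^ 1) 438751 ψ ≠ 0 ∧
        ∀ d : ℕ, d ∣ 438751 → 1 < d → d < 438751 → ∀ [NeZero d], kuriharaNumber D.f (3 ^ 1) d ψ = 0) :
    haveI : Fact (Nat.Prime 3) := ⟨Nat.prime_three⟩
    BSDp W 3 := by
  haveI : Fact (Nat.Prime 3) := ⟨Nat.prime_three⟩
  haveI : NeZero (438751 : ℕ) := ⟨by norm_num⟩
  obtain ⟨ψ, hψ, hcert, hv⟩ := hδ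
  have htam : ¬ 3 ∣ W.tamagawaProduct := by rw [tamagawaProduct_v17190k1 hI]; decide
  have hc3 : ¬ 3 ∣ (W.baseChange ℚ_[3]).localTamagawaNumber ℤ_[3] := fun h =>
    htam (h.trans (localTamagawaNumber_padic_dvd_tamagawaProduct W 3))
  have hjneg : padicValRat 3 W.j < 0 :=
    padicValRat_j_neg_of_intModel hI 3 2 (by decide +kernel) (by decide +kernel)
  exact Assembly.bsdp_three_potMult_of_towerSurj_of_kolyvaginProduct_deep hKatoS hDel hGZK hmod hmodD
    hL20 hKatoχ h26 hS24d hS24d₂ W 1 hI (by decide +kernel) (by decide +kernel) (towerSurj3_v17190k1 hI)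
    (LocalTorsion3.natCard_threeTorsion_17190k1 W hI) hr hjneg hc3 (by norm_num) D hopt inv hperf hsum
    hcompl inv' hperf' hsum' hcompl' hinj' hEP v₃ hv₃ hPort 438751 (isKolyvaginProduct_three_v17190k1 hI)
    (forall_card_torsion_le_v17190k1 hI) forall_not_dvd_level_v17190k1 ψ hψ hcert hv

end Summit.BirchSwinnertonDyer.Rank1Residual.Additive.X4ThreeKuriharaCert

end
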